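import Summits.Ventures.CertifiedArithmetic.LowPrec.SRDoubleRoundingOrder
import HarnessLib

/-!
# Block-scaled (MX-style) quantisation under stochastic rounding, I: the scaled step (file LI)

HONEST FRAMING: certified error envelopes and provably optimal rounding/accumulation schemes for
low-precision formats under stated cost models; every table by two implementations; no hardware or
vendor claims.

Block formats (OCP MX, NVFP4) store an element `v` as `s · P` with a shared block scale `s > 0`
and an element `P` of a narrow format `F`; under stochastic rounding `P = SR_F(v / s)` and the
value delivered is the DEQUANTISED `s · SR_F(v / s)` (saturating at `± s · max F`).  This file is
the exact one-element theory, for an arbitrary nonempty finite `F` in a linearly ordered field and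
then for every minifloat format `φ` (`F = valueSet φ`, subnormals and all):

* `scaledStep F s v f = E f(s · SR_F(v / s))` — the expectation operator of the dequantised value;
* `scaledStep_id` — MEAN `= s · clamp_F(v / s)`; `scaledStep_id_eq_self_iff` — UNBIASED EXACTLY
  WHEN `v / s` LIES IN THE HULL of `F` (for a format: `|v| ≤ s · maxRat`, `mx_unbiased_iff`); when
  the scale is too small the mean is `± s · maxRat` surely (`mx_mean_of_clip_pos/neg`) — the
  clipping bias that [TsengYuPark2025, §3.1] observe for the OCP floor scale ("values scaled to
  between 6 and 8 will get clipped") and that the headroom factors 3/4 (ibid., Lemma 3.1) and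
  6·16/17 ([PanferovEtAl2026, §3]) are designed to avoid, here as an iff;
* `scaledStep_sq` — VARIANCE `= s² · v_F(v / s)` (El Arar et al.'s two-point variance at the
  scaled point); `mx_var_le` — the per-element envelope `≤ max (s²·quantum²/4) (u²·v²)` from the
  spacing law of the format (`SRSpacing`);
* `step_le_step_div` — **COARSENING THE SCALE NEVER LOWERS A CONVEX RISK**: if the candidates of
  `c / a` multiplied back by `a` are representable, then for every convex test function `h`,
  `E h(SR_F(c)) ≤ E h(a · SR_F(c / a))` (chord-under-chord: the fine cell sits inside the coarse
  one); for formats, `mx_double_le` / `mx_pow_le`: doubling an admissible scale (one with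
  `|v| ≤ s · maxRat`) can only increase `E ℓ(s · SR(v/s))` for every convex `ℓ` — squared error,
  absolute error, every moment `|· − v|^p`, exponential moments.  Consequence drawn in file LII:
  under SR the LEAST non-clipping power-of-two scale is optimal for every convex loss at once, so
  unbiased block quantisation has no scale-selection dilemma among powers of two (contrast
  round-to-nearest, where the two neighbouring scales must be compared per block).

References: [ConnollyHighamMary2021] Lemma 4.4; [ArarEtAl2023] §3; [RouhaniEtAl2023MX] §3
(Algorithm 1); [TsengYuPark2025] §3.1, Lemma 3.1; [MishraEtAl2025] Algorithm 1 (round the shared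
exponent up); [PanferovEtAl2026] §3; [CookEtAl2025] §3 (two candidate scales).  All statements
here are new as exact finite-format theorems; the cited papers state the unbiasedness of
non-clipping SR informally or under a real-arithmetic model.
-/

namespace Summit.Ventures.CertifiedArithmetic.LowPrec.SR

open Literature.ComputerArithmetic.ConnollyHighamMary2021
open Finset

section Generic

variable {K : Type*} [Field K] [LinearOrder K] [IsStrictOrderedRing K]

/-! ### Chords of convex functions and convexity under rescaling -/

/-- A convex function lies BELOW the chord of `[d, u]` inside the interval (endpoints included).
[Mathlib `ConvexOn.secant_mono_aux1`, rearranged] -/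
theorem le_chord_of_convexOn {f : K → K} (hf : ConvexOn K Set.univ f) {d u w : K} (hdu : d < u)
    (hdw : d ≤ w) (hwu : w ≤ u) : f w ≤ f d + (w - d) * ((f u - f d) / (u - d)) := by
  have hud : 0 < u - d := sub_pos.mpr hdu
  have hk : (u - d) * ((f u - f d) / (u - d)) = f u - f d := by field_simp
  rcases eq_or_lt_of_le hdw with rfl | hdw'
  · simp
  rcases eq_or_lt_of_le hwu with rfl | hwu'
  · rw [hk]; simp
  have h := hf.secant_mono_aux1 (Set.mem_univ d) (Set.mem_univ u) hdw' hwu'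
  refine le_of_mul_le_mul_left ?_ hud
  have key : (u - d) * (f d + (w - d) * ((f u - f d) / (u - d)))
      = (u - w) * f d + (w - d) * f u := by
    have e : (u - d) * (f d + (w - d) * ((f u - f d) / (u - d)))
        = (u - d) * f d + (w - d) * ((u - d) * ((f u - f d) / (u - d))) := by ring
    rw [e, hk]; ring
  rw [key]; exact h

/-- Convexity is preserved by an affine change of variable `t ↦ a t + b`. [folklore] -/
theorem convexOn_comp_affine {f : K → K} (hf : ConvexOn K Set.univ f) (a b : K) :
    ConvexOn K Set.univ (fun t => f (a * t + b)) := by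
  refine ⟨convex_univ, fun x _ y _ p q hp hq hpq => ?_⟩
  have key := hf.2 (Set.mem_univ (a * x + b)) (Set.mem_univ (a * y + b)) hp hq hpq
  simp only [smul_eq_mul] at key ⊢
  have e : a * (p * x + q * y) + b = p * (a * x + b) + q * (a * y + b) := by
    linear_combination (-b) * hpq
  rw [e]; exact key

/-- Convexity is preserved by a linear change of variable `t ↦ a t`. [folklore] -/
theorem convexOn_comp_mul {f : K → K} (hf : ConvexOn K Set.univ f) (a : K) :
    ConvexOn K Set.univ (fun t => f (a * t)) := by
  have h := convexOn_comp_affine hf a 0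
  simp only [add_zero] at h
  exact h

/-- Convexity is preserved by a shift of the argument `t ↦ t - b`. [folklore] -/
theorem convexOn_comp_sub {f : K → K} (hf : ConvexOn K Set.univ f) (b : K) :
    ConvexOn K Set.univ (fun t => f (t - b)) := by
  have h := convexOn_comp_affine hf 1 (-b)
  simp only [one_mul, ← sub_eq_add_neg] at h
  exact h

omit [IsStrictOrderedRing K] in
/-- One step only sees its two candidates: monotonicity through the leaves. -/
theorem step_mono_candidates (F : Finset K) (c : K) {f g : K → K}
    (hu : f (up F c) ≤ g (up F c)) (hd : f (dn F c) ≤ g (dn F c))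
    [IsStrictOrderedRing K] : step F c f ≤ step F c g := by
  unfold step
  have hp := pUp_nonneg F c
  have hq : 0 ≤ 1 - pUp F c := sub_nonneg.mpr (pUp_le_one F c)
  exact add_le_add (mul_le_mul_of_nonneg_left hu hp) (mul_le_mul_of_nonneg_left hd hq)

/-! ### Coarsening the grid never lowers a convex risk -/

/-- **COARSENING THE SCALE NEVER LOWERS A CONVEX RISK.**  Let `a > 0`, let `c / a` lie in the hull
of `F`, and suppose both candidates of `c / a`, multiplied back by `a`, are values of `F`.  Then
for every convex `h`: `E h(SR_F(c)) ≤ E h(a · SR_F(c / a))`.  (The two candidates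
`a⌊c/a⌋ ≤ c ≤ a⌈c/a⌉` are in `F`, so the cell of `c` sits inside `[a⌊c/a⌋, a⌈c/a⌉]`; one SR step is
the chord of `h` over its cell evaluated at `c` (`step_eq_affine`), and the chord over an inner
interval lies below the chord over an outer one.)  Every finite `F`, no spacing hypothesis. [new] -/
theorem step_le_step_div {F : Finset K} {c a : K} (ha : 0 < a) (hca : InHull F (c / a))
    (hd : a * dn F (c / a) ∈ F) (hu : a * up F (c / a) ∈ F) {h : K → K}
    (hh : ConvexOn K Set.univ h) : step F c h ≤ step F (c / a) (fun t => h (a * t)) := by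
  have h1 : dn F (c / a) ≤ c / a := by simpa [clamp_eq_self hca] using dn_le_clamp F (c / a)
  have h2 : c / a ≤ up F (c / a) := by simpa [clamp_eq_self hca] using clamp_le_up F (c / a)
  have hA : a * dn F (c / a) ≤ c := by
    have := mul_le_mul_of_nonneg_left h1 ha.le; rwa [mul_div_cancel₀ _ ha.ne'] at this
  have hB : c ≤ a * up F (c / a) := by
    have := mul_le_mul_of_nonneg_left h2 ha.le; rwa [mul_div_cancel₀ _ ha.ne'] at this
  have hc : InHull F c := ⟨⟨_, hd, hA⟩, ⟨_, hu, hB⟩⟩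
  have hdc : dn F c ≤ c := by simpa [clamp_eq_self hc] using dn_le_clamp F c
  have hcu : c ≤ up F c := by simpa [clamp_eq_self hc] using clamp_le_up F c
  have hlo : a * dn F (c / a) ≤ dn F c := le_dn_of_mem hd hA
  have hhi : up F c ≤ a * up F (c / a) := up_le_of_mem hu hB
  -- the chord `L y = h(A) + (y - A) m` of `h` over `[A, B] = [a⌊c/a⌋, a⌈c/a⌉]`
  have hdom : ∀ y, a * dn F (c / a) ≤ y → y ≤ a * up F (c / a) →
      h y ≤ h (a * dn F (c / a)) + (y - a * dn F (c / a)) *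
        ((h (a * up F (c / a)) - h (a * dn F (c / a))) / (a * up F (c / a) - a * dn F (c / a))) := by
    intro y hy1 hy2
    rcases eq_or_lt_of_le (hy1.trans hy2) with he | hlt
    · have hy : y = a * dn F (c / a) := le_antisymm (he ▸ hy2) hy1
      rw [hy]; simp
    · exact le_chord_of_convexOn hh hlt hy1 hy2
  -- the coarse step IS `L c`
  have hR : step F (c / a) (fun t => h (a * t)) = h (a * dn F (c / a)) + (c - a * dn F (c / a)) *
      ((h (a * up F (c / a)) - h (a * dn F (c / a))) / (a * up F (c / a) - a * dn F (c / a))) := by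
    rw [step_eq_affine hca h1 h2]
    rcases eq_or_ne (up F (c / a)) (dn F (c / a)) with he | hne
    · rw [he]; simp
    · have hne' : up F (c / a) - dn F (c / a) ≠ 0 := sub_ne_zero.mpr hne
      have hane : a * up F (c / a) - a * dn F (c / a) ≠ 0 := by
        rw [← mul_sub]; exact mul_ne_zero ha.ne' hne'
      field_simp
  calc step F c h
      ≤ step F c (fun y => h (a * dn F (c / a)) + (y - a * dn F (c / a)) *
          ((h (a * up F (c / a)) - h (a * dn F (c / a))) /
            (a * up F (c / a) - a * dn F (c / a)))) :=
        step_mono_candidates F c (hdom _ (hlo.trans (hdc.trans hcu)) hhi)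
          (hdom _ hlo (hdc.trans (hcu.trans hhi)))
    _ = h (a * dn F (c / a)) + (c - a * dn F (c / a)) *
          ((h (a * up F (c / a)) - h (a * dn F (c / a))) /
            (a * up F (c / a) - a * dn F (c / a))) := step_affine_of_inHull hc _ _ _
    _ = step F (c / a) (fun t => h (a * t)) := hR.symm

/-! ### The scaled step: mean, unbiasedness, variance -/

/-- `E f(s · SR_F(v / s))`: the expectation of a test function of the DEQUANTISED value when `v`
is quantised into `F` with block scale `s` under (saturating) stochastic rounding. -/
def scaledStep (F : Finset K) (s v : K) (f : K → K) : K := step F (v / s) (fun t => f (s * t))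

omit [IsStrictOrderedRing K] in
/-- **MEAN of block-scaled SR**: `E[s · SR_F(v/s)] = s · clamp_F(v / s)`. -/
theorem scaledStep_id (F : Finset K) (s v : K) [IsStrictOrderedRing K] :
    scaledStep F s v (fun y => y) = s * clamp F (v / s) := by
  unfold scaledStep; rw [step_mul_left, step_id]

omit [IsStrictOrderedRing K] in
/-- **UNBIASED EXACTLY WHEN THE SCALED VALUE IS IN THE HULL**: for `s ≠ 0` and nonempty `F`,
`E[s · SR_F(v/s)] = v ↔ v / s ∈ [min F, max F]`. -/
theorem scaledStep_id_eq_self_iff {F : Finset K} (hF : F.Nonempty) {s : K} (hs : s ≠ 0) (v : K)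
    [IsStrictOrderedRing K] : scaledStep F s v (fun y => y) = v ↔ InHull F (v / s) := by
  rw [scaledStep_id, ← clamp_eq_self_iff hF]
  constructor
  · intro h
    have : clamp F (v / s) = v / s := by rw [eq_div_iff hs, mul_comm]; exact h
    exact this
  · intro h; rw [h, mul_div_cancel₀ _ hs]

/-- **VARIANCE of block-scaled SR** (unclipped element): `E (s · SR_F(v/s) − v)² = s² · v_F(v/s)`
with El Arar et al.'s `v_F(x) = (x − ⌊x⌋)(⌈x⌉ − x)` (`srVar`). -/
theorem scaledStep_sq {F : Finset K} {s v : K} (hs : s ≠ 0) (hv : InHull F (v / s)) :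
    scaledStep F s v (fun y => (y - v) ^ 2) = s ^ 2 * srVar F (v / s) := by
  unfold scaledStep
  have e : (fun t => (s * t - v) ^ 2) = fun t => s ^ 2 * (t + -(v / s)) ^ 2 := by
    funext t; field_simp; ring
  rw [e, step_mul_left, step_sq_add, clamp_eq_self hv]; ring

/-- **Every convex risk of block-scaled SR grows when the scale is coarsened by an admissible
factor**: `a > 0`, `v/(a s)` in the hull, and the two candidates of `v/(a s)` times `a` in `F` ⟹
`E h(s·SR(v/s)) ≤ E h((a s)·SR(v/(a s)))` for every convex `h`. -/
theorem scaledStep_le_mul {F : Finset K} {s v a : K} (ha : 0 < a)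
    (hva : InHull F (v / (a * s))) (hd : a * dn F (v / (a * s)) ∈ F)
    (hu : a * up F (v / (a * s)) ∈ F) {h : K → K} (hh : ConvexOn K Set.univ h) :
    scaledStep F s v h ≤ scaledStep F (a * s) v h := by
  unfold scaledStep
  have hdiv : v / s / a = v / (a * s) := by rw [div_div, mul_comm]
  have key := step_le_step_div (c := v / s) ha (hdiv ▸ hva) (hdiv ▸ hd) (hdiv ▸ hu)
    (convexOn_comp_mul hh s)
  have e : (fun t => (fun t => h (s * t)) (a * t)) = fun t => h (a * s * t) := by
    funext t; exact congrArg h (by ring)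
  rw [hdiv, e] at key
  exact key

end Generic

/-! ### Minifloat formats: `F = valueSet φ`, hull `[−maxRat, maxRat]` -/

section Formats

open Literature.ComputerArithmetic.FloatingPoint

variable {φ : Format}

/-- Doubling stays in the format while in range (signed form of `two_mul_mem_valueSet`). -/
theorem two_mul_mem_valueSet_of_abs {x : ℚ} (hx : x ∈ MiniFloat.valueSet φ)
    (h2 : 2 * |x| ≤ φ.maxRat) : 2 * x ∈ MiniFloat.valueSet φ := by
  obtain ⟨a, rfl⟩ := MiniFloat.mem_valueSet.mp hx
  rcases le_or_gt 0 a.toRat with ha | ha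
  · rw [abs_of_nonneg ha] at h2; exact two_mul_mem_valueSet ha h2
  · have ha' : 0 ≤ a.flipSign.toRat := by rw [MiniFloat.toRat_flipSign]; linarith
    have h2' : 2 * a.flipSign.toRat ≤ φ.maxRat := by
      rw [MiniFloat.toRat_flipSign]; rw [abs_of_neg ha] at h2; linarith
    have := neg_mem_valueSet (two_mul_mem_valueSet ha' h2')
    rw [MiniFloat.toRat_flipSign] at this
    convert this using 1; ring

/-- **Half the top value is a value** as soon as the format has at least two binades above the
subnormal one (`2^(m+1) ≤ maxScaled`; every OCP / IEEE format, `two_pow_le_maxScaled_formats`). -/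
theorem half_maxRat_mem_valueSet (h : 2 ^ (φ.manBits + 1) ≤ φ.maxScaled) :
    φ.maxRat / 2 ∈ MiniFloat.valueSet φ := by
  have h0 : 0 ≤ (MiniFloat.top φ).toRat := by
    rw [MiniFloat.toRat_top]
    exact (abs_nonneg _).trans (MiniFloat.abs_toRat_le_maxRat (MiniFloat.top φ))
  rcases half_mem_valueSet_or_lt (MiniFloat.top φ) h0 with h1 | h1
  · rwa [MiniFloat.toRat_top] at h1
  · have h1' : φ.maxScaled < 2 ^ (φ.manBits + 1) := h1
    exact absurd h1' (not_lt.mpr h)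

/-- The binade hypothesis `2^(m+1) ≤ maxScaled` for the OCP element formats and `Binary16`. -/
theorem two_pow_le_maxScaled_formats :
    2 ^ (Format.E2M1.manBits + 1) ≤ Format.E2M1.maxScaled ∧
    2 ^ (Format.E2M3.manBits + 1) ≤ Format.E2M3.maxScaled ∧
    2 ^ (Format.E3M2.manBits + 1) ≤ Format.E3M2.maxScaled ∧
    2 ^ (Format.E4M3.manBits + 1) ≤ Format.E4M3.maxScaled ∧
    2 ^ (Format.E5M2.manBits + 1) ≤ Format.E5M2.maxScaled := by
  decide

/-- At or above `maxRat`, saturation returns `maxRat`. -/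
theorem clamp_valueSet_of_maxRat_le {x : ℚ} (hx : φ.maxRat ≤ x) :
    clamp (MiniFloat.valueSet φ) x = φ.maxRat := by
  have hF := MiniFloat.valueSet_nonempty φ
  refine le_antisymm ?_ ((le_dn_of_mem (MiniFloat.maxRat_mem_valueSet φ) hx).trans (dn_le_clamp _ x))
  obtain ⟨z, hz, hcz⟩ := (clamp_inHull hF x).2
  exact hcz.trans ((le_abs_self z).trans (abs_le_maxRat_of_mem_valueSet hz))

/-- At or below `−maxRat`, saturation returns `−maxRat`. -/
theorem clamp_valueSet_of_le_neg_maxRat {x : ℚ} (hx : x ≤ -φ.maxRat) :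
    clamp (MiniFloat.valueSet φ) x = -φ.maxRat := by
  have hF := MiniFloat.valueSet_nonempty φ
  refine le_antisymm ((clamp_le_up _ x).trans (up_le_of_mem (MiniFloat.neg_maxRat_mem_valueSet φ) hx)) ?_
  obtain ⟨z, hz, hzc⟩ := (clamp_inHull hF x).1
  exact le_trans (by linarith [neg_abs_le z, abs_le_maxRat_of_mem_valueSet hz]) hzc

/-- In-range criterion for a scaled element: `v / s` in the hull iff `|v| ≤ s · maxRat` (`s > 0`). -/
theorem inHull_div_iff {s : ℚ} (hs : 0 < s) (v : ℚ) :
    InHull (MiniFloat.valueSet φ) (v / s) ↔ |v| ≤ s * φ.maxRat := by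
  rw [valueSet_inHull_iff, abs_div, abs_of_pos hs, div_le_iff₀ hs, mul_comm]

/-- **MX ELEMENT UNDER SR IS UNBIASED IFF IT DOES NOT CLIP**: for a scale `s > 0`,
`E[s · SR_φ(v/s)] = v ↔ |v| ≤ s · maxRat`.  The informal "SR does not clip its arguments, and the
resulting estimation is unbiased" of [PanferovEtAl2026, §3] / [TsengYuPark2025, Lemma 3.1], as an
iff in the exact finite format (subnormal elements included: they are never an obstruction). -/
theorem mx_unbiased_iff {s : ℚ} (hs : 0 < s) (v : ℚ) :
    scaledStep (MiniFloat.valueSet φ) s v (fun y => y) = v ↔ |v| ≤ s * φ.maxRat := by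
  rw [scaledStep_id_eq_self_iff (MiniFloat.valueSet_nonempty φ) hs.ne' v, inHull_div_iff hs]

/-- **CLIPPING BIAS, positive side**: if `s · maxRat ≤ v` the dequantised value is `s · maxRat`
surely, so the mean is `s · maxRat` (bias `v − s·maxRat`, e.g. scaled values in `(6, 8)` under the
OCP floor scale for FP4, [TsengYuPark2025, §3.1]). -/
theorem mx_mean_of_clip_pos {s v : ℚ} (hs : 0 < s) (h : s * φ.maxRat ≤ v) :
    scaledStep (MiniFloat.valueSet φ) s v (fun y => y) = s * φ.maxRat := by
  rw [scaledStep_id, clamp_valueSet_of_maxRat_le]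
  rwa [le_div_iff₀ hs, mul_comm]

/-- **CLIPPING BIAS, negative side**: if `v ≤ −s · maxRat` the mean is `−s · maxRat`. -/
theorem mx_mean_of_clip_neg {s v : ℚ} (hs : 0 < s) (h : v ≤ -(s * φ.maxRat)) :
    scaledStep (MiniFloat.valueSet φ) s v (fun y => y) = -(s * φ.maxRat) := by
  rw [scaledStep_id, clamp_valueSet_of_le_neg_maxRat]
  · ring
  · rw [div_le_iff₀ hs]; linarith

/-- **VARIANCE of an unclipped MX element under SR**: `E (s·SR(v/s) − v)² = s² · v_φ(v/s)`. -/
theorem mx_var_eq {s v : ℚ} (hs : 0 < s) (hv : |v| ≤ s * φ.maxRat) :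
    scaledStep (MiniFloat.valueSet φ) s v (fun y => (y - v) ^ 2)
      = s ^ 2 * srVar (MiniFloat.valueSet φ) (v / s) :=
  scaledStep_sq hs.ne' ((inHull_div_iff hs v).mpr hv)

/-- **PER-ELEMENT VARIANCE ENVELOPE from the spacing law**: for an unclipped element,
`E (s·SR(v/s) − v)² ≤ max (s²·quantum²/4) (u²·v²)` — absolute floor `s·quantum/2` (half the scaled
subnormal spacing) and relative level `u·|v|` (`u = 2^{-(m+1)}`), whichever is larger. -/
theorem mx_var_le {s v : ℚ} (hs : 0 < s) (hv : |v| ≤ s * φ.maxRat) :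
    scaledStep (MiniFloat.valueSet φ) s v (fun y => (y - v) ^ 2)
      ≤ max (s ^ 2 * φ.quantum ^ 2 / 4) (φ.unitRoundoff ^ 2 * v ^ 2) := by
  have hc : InHull (MiniFloat.valueSet φ) (v / s) := (inHull_div_iff hs v).mpr hv
  rw [mx_var_eq hs hv]
  have hgap := valueSet_gap_le_max φ hc
  have hq := φ.quantum_pos
  have hu := φ.unitRoundoff_pos
  have habs : |v / s| = |v| / s := by rw [abs_div, abs_of_pos hs]
  have h0 : 0 ≤ roundUp (MiniFloat.valueSet φ) (v / s) - roundDown (MiniFloat.valueSet φ) (v / s) :=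
    sub_nonneg.mpr (roundDown_le_roundUp _ _)
  have hsv := srVar_le_gap_sq_div_four (MiniFloat.valueSet φ) (v / s)
  rcases le_total φ.quantum (2 * φ.unitRoundoff * |v / s|) with hle | hle
  · rw [max_eq_right hle] at hgap
    have h1 : srVar (MiniFloat.valueSet φ) (v / s) ≤ (2 * φ.unitRoundoff * |v / s|) ^ 2 / 4 :=
      hsv.trans (by nlinarith [mul_self_le_mul_self h0 hgap])
    refine le_trans ?_ (le_max_right _ _)
    have e : s ^ 2 * ((2 * φ.unitRoundoff * |v / s|) ^ 2 / 4) = φ.unitRoundoff ^ 2 * v ^ 2 := by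
      rw [habs]; field_simp; rw [sq_abs]; ring
    calc s ^ 2 * srVar (MiniFloat.valueSet φ) (v / s)
        ≤ s ^ 2 * ((2 * φ.unitRoundoff * |v / s|) ^ 2 / 4) :=
          mul_le_mul_of_nonneg_left h1 (sq_nonneg s)
      _ = φ.unitRoundoff ^ 2 * v ^ 2 := e
  · rw [max_eq_left hle] at hgap
    have h1 : srVar (MiniFloat.valueSet φ) (v / s) ≤ φ.quantum ^ 2 / 4 :=
      hsv.trans (by nlinarith [mul_self_le_mul_self h0 hgap])
    refine le_trans ?_ (le_max_left _ _)
    calc s ^ 2 * srVar (MiniFloat.valueSet φ) (v / s)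
        ≤ s ^ 2 * (φ.quantum ^ 2 / 4) := mul_le_mul_of_nonneg_left h1 (sq_nonneg s)
      _ = s ^ 2 * φ.quantum ^ 2 / 4 := by ring

/-- **DOUBLING AN ADMISSIBLE SCALE NEVER LOWERS A CONVEX RISK** (formats): if `|v| ≤ s·maxRat`
(scale `s` does not clip `v`) then for every convex `h`, `E h(s·SR_φ(v/s)) ≤ E h(2s·SR_φ(v/(2s)))`.
Hypothesis `2^(m+1) ≤ maxScaled`: the format has a binade below the top one, so that `maxRat/2`
is a value and the candidates of `v/(2s)` double back into the format. -/
theorem mx_double_le (hφ : 2 ^ (φ.manBits + 1) ≤ φ.maxScaled) {s v : ℚ} (hs : 0 < s)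
    (hv : |v| ≤ s * φ.maxRat) {h : ℚ → ℚ} (hh : ConvexOn ℚ Set.univ h) :
    scaledStep (MiniFloat.valueSet φ) s v h ≤ scaledStep (MiniFloat.valueSet φ) (2 * s) v h := by
  have hF := MiniFloat.valueSet_nonempty φ
  have h2s : 0 < 2 * s := by positivity
  have hsm : 0 ≤ s * φ.maxRat := (abs_nonneg v).trans hv
  have hva : InHull (MiniFloat.valueSet φ) (v / (2 * s)) :=
    (inHull_div_iff h2s v).mpr (hv.trans (by linarith))
  have hhalf := half_maxRat_mem_valueSet hφ
  have hnhalf : -(φ.maxRat / 2) ∈ MiniFloat.valueSet φ := neg_mem_valueSet hhalf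
  -- the scaled value and its candidates lie in `[−maxRat/2, maxRat/2]`
  have hvlo : -(φ.maxRat / 2) ≤ v / (2 * s) := by
    rw [le_div_iff₀ h2s]; nlinarith [neg_abs_le v]
  have hvhi : v / (2 * s) ≤ φ.maxRat / 2 := by
    rw [div_le_iff₀ h2s]; nlinarith [le_abs_self v]
  have hceq : clamp (MiniFloat.valueSet φ) (v / (2 * s)) = v / (2 * s) := clamp_eq_self hva
  have hdlo : -(φ.maxRat / 2) ≤ dn (MiniFloat.valueSet φ) (v / (2 * s)) := le_dn_of_mem hnhalf hvlo
  have hdhi : dn (MiniFloat.valueSet φ) (v / (2 * s)) ≤ φ.maxRat / 2 :=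
    le_trans (by simpa [hceq] using dn_le_clamp (MiniFloat.valueSet φ) (v / (2 * s))) hvhi
  have hulo : -(φ.maxRat / 2) ≤ up (MiniFloat.valueSet φ) (v / (2 * s)) :=
    hvlo.trans (by simpa [hceq] using clamp_le_up (MiniFloat.valueSet φ) (v / (2 * s)))
  have huhi : up (MiniFloat.valueSet φ) (v / (2 * s)) ≤ φ.maxRat / 2 := up_le_of_mem hhalf hvhi
  have hd : 2 * dn (MiniFloat.valueSet φ) (v / (2 * s)) ∈ MiniFloat.valueSet φ :=
    two_mul_mem_valueSet_of_abs (dn_mem hF _) (by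
      have h' : |dn (MiniFloat.valueSet φ) (v / (2 * s))| ≤ φ.maxRat / 2 :=
        abs_le.mpr ⟨by linarith, hdhi⟩
      linarith)
  have hu : 2 * up (MiniFloat.valueSet φ) (v / (2 * s)) ∈ MiniFloat.valueSet φ :=
    two_mul_mem_valueSet_of_abs (up_mem hF _) (by
      have h' : |up (MiniFloat.valueSet φ) (v / (2 * s))| ≤ φ.maxRat / 2 :=
        abs_le.mpr ⟨by linarith, huhi⟩
      linarith)
  exact scaledStep_le_mul two_pos hva hd hu hh

/-- **Iterated**: every admissible scale `s` beats `2^n · s` for every convex risk. -/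
theorem mx_pow_le (hφ : 2 ^ (φ.manBits + 1) ≤ φ.maxScaled) {s v : ℚ} (hs : 0 < s)
    (hv : |v| ≤ s * φ.maxRat) {h : ℚ → ℚ} (hh : ConvexOn ℚ Set.univ h) (n : ℕ) :
    scaledStep (MiniFloat.valueSet φ) s v h ≤ scaledStep (MiniFloat.valueSet φ) (2 ^ n * s) v h := by
  induction n with
  | zero => simp
  | succ n ih =>
    have hs' : 0 < 2 ^ n * s := by positivity
    have hv' : |v| ≤ 2 ^ n * s * φ.maxRat := hv.trans (by
      have : (1 : ℚ) ≤ 2 ^ n := one_le_pow₀ (by norm_num)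
      have hM : 0 ≤ s * φ.maxRat := (abs_nonneg v).trans hv
      nlinarith)
    calc scaledStep (MiniFloat.valueSet φ) s v h
        ≤ scaledStep (MiniFloat.valueSet φ) (2 ^ n * s) v h := ih
      _ ≤ scaledStep (MiniFloat.valueSet φ) (2 * (2 ^ n * s)) v h := mx_double_le hφ hs' hv' hh
      _ = scaledStep (MiniFloat.valueSet φ) (2 ^ (n + 1) * s) v h := by rw [pow_succ]; ring_nf

end Formats

end Summit.Ventures.CertifiedArithmetic.LowPrec.SR
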